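import Literature.MathematicalPhysics.QuantumFieldTheory.ConformalBootstrap3D.PointKernelK34Data

/-!
# K34 certificate, kernel block file M6: (M) rows `68 ≤ j < 86` of `mrows`, in 7 row groups

`decide` by kernel reduction (no `native_decide`, no extra axioms) of the block checker of
`PointKernel` on the literal data of `PointKernelK34Data`; soundness is `PCert.mBlockOK_sound`.
Estimated kernel time 180 s (7 theorems).
-/

set_option maxRecDepth 100000
set_option maxHeartbeats 0

namespace Literature.MathematicalPhysics.QuantumFieldTheory.ConformalBootstrap3D.PointKernelK34

open Literature.MathematicalPhysics.QuantumFieldTheory.ConformalBootstrap3D.PointKernel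

/-- (M) rows `[68, 70)` pass the kernel evaluator. [folklore] -/
theorem mBlock_68 : cert.mBlockOK mrows 68 70 = true := by
  decide +kernel

/-- (M) rows `[70, 72)` pass the kernel evaluator. [folklore] -/
theorem mBlock_70 : cert.mBlockOK mrows 70 72 = true := by
  decide +kernel

/-- (M) rows `[72, 74)` pass the kernel evaluator. [folklore] -/
theorem mBlock_72 : cert.mBlockOK mrows 72 74 = true := by
  decide +kernel

/-- (M) rows `[74, 77)` pass the kernel evaluator. [folklore] -/
theorem mBlock_74 : cert.mBlockOK mrows 74 77 = true := by
  decide +kernel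

/-- (M) rows `[77, 80)` pass the kernel evaluator. [folklore] -/
theorem mBlock_77 : cert.mBlockOK mrows 77 80 = true := by
  decide +kernel

/-- (M) rows `[80, 83)` pass the kernel evaluator. [folklore] -/
theorem mBlock_80 : cert.mBlockOK mrows 80 83 = true := by
  decide +kernel

/-- (M) rows `[83, 86)` pass the kernel evaluator. [folklore] -/
theorem mBlock_83 : cert.mBlockOK mrows 83 86 = true := by
  decide +kernel

end Literature.MathematicalPhysics.QuantumFieldTheory.ConformalBootstrap3D.PointKernelK34
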